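import Summits.Ventures.CertifiedManyBodySolver.Certificates.HubbardSquare_n7o8_pinning_menus_tPrimeBox_pairAmpCeilings
import Summits.Ventures.CertifiedManyBodySolver.Certificates.HubbardSquare_n7o8_boxword_cuprate_box3d
import Summits.Ventures.CertifiedManyBodySolver.Certificates.HubbardSquare_n1_upper_pb2_U8_row472
import Literature.MathematicalPhysics.QuantumLattice.DWaveSourceCapClassFillingTransport
import Literature.MathematicalPhysics.QuantumLattice.HubbardFillingBoxEnergyBounds
import Literature.MathematicalPhysics.QuantumLattice.HubbardEnergyDensityChordBounds
import HarnessLib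
import HarnessLib.Audit

/-!
# Ventures/CertifiedManyBodySolver — Certificates/HubbardSquare_n7o8_pinning_menuA0_fillingBox_pairAmpCeilings.lean

HONEST FRAMING: first certified bounds; not a superconductivity verdict; every number certified or labelled float. A CEILING on a
`d`-wave pair amplitude never speaks to the presence or absence of order; no phase sentence; CANDIDATE until the named node is
referee-replayed. WHAT-THIS-IS-NOT: a floor; a number of record beyond its named premises; a statement at any `U ≠ 8`.

THE FILLING (`n`) EXTENT OF THE CUPRATE-BOX ORDER WORD (stage S2 «points → boxes», THIRD axis; seat hubbard-box-p3 g5, cell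
`pub/hubbard-fast`). The pinning menus are solved at ONE density `n₀ = 7/8`; no interval-filling menu exists. The Literature leaf
`DWaveSourceCapClassFillingTransport.lean` (this seat) transports the PRICED node «∀ σ TI of density 7/8:
√2·Re σ(P₀^d) ≤ M̃ + κ·(E^{src}_{A0}(σ) − hi₄₄₅)» to every other density by MIXING the target state with a partner: the Fock VACUUM
for `n > 7/8` (price `((n − 7/8)/(7/8))·(M̃ − κ·hi₄₄₅)`), a gauge-symmetric half-filled state below the certified half-filling cap for
`n < 7/8` (price `8(7/8 − n)·(M̃ + κ·(C₄₇₂ − hi₄₄₅))`). INPUTS BY NAME: (i) hubbard-obs-pin-1's priced node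
`cert_pin2_A0menu_L2_U8_n7o8_tpm1o4_g0_pairAmpMax_priced_j256528` (A0 = (8, 7/8, −1/4), L2, g = 0: the ORDER class, field `h = 0`;
M̃ = 1.0748043, κ = 1.1906556); (ii) the anchor cap #445 (`cert_dbt329pair_allk`, hi₄₄₅ = −0.6866418); (iii) the half-filling cap #472
(`cert_r472_pb2_tl_upper_n1_U8`, `e(1,0,8;1) ≤ C₄₇₂ = −0.5087724`, carried to every `t'` by evenness + concavity at `n = 1`,
`box3d_halfFilling_cap_of_tp0`); (iv) target caps by convexity in the density (`energyDensityTT'_le_density_chord`,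
`energyDensityTT'_le_vacuum_chord`, `energyDensityTT'_le_max_of_mem_Icc`) and, on the `t'`-box, the kinematic `16/π² < 1.6212`
transport of #445 (`energyDensityTT'_le_of_upperBound_tPrime_kinematic`). OUTPUT (§1 generic slots, §2 the anchor column
`(U, t') = (8, −1/4)`, §3 the `(t', n)` face `[−3/10, −1/5] × [173/200, 177/200]` at `U = 8`): every translation-invariant density-`n`
GROUND STATE of the unsourced `t–t'` Hubbard model has `d`-wave pair amplitude

  **`Re ω(P₀^d) ≤ 0.7872742` on `n ∈ [0.875, 0.885]`, `≤ 0.8393886` on `n ∈ [0.865, 0.875]` at `(8, −1/4)`** (anchor point 0.7600015), and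
  **`≤ 0.9183067` / `≤ 0.9751008` on the same two halves uniformly in `t' ∈ [−0.30, −0.20]`** (`U = 8`; kinematic registry-only
  edition — the `t'`-extent alone was `0.8964936`, `…menus_tPrimeBox_pairAmpCeilings`).

With the `t'`-extent (p486616/p487004) and the `(t', U)` face (p487426/p488340) this closes the third axis of the first object's ORDER
word from ONE menu node; the `U`-extent of the filling slab is the same one-liner through `…_filling_…_tPrime_U` (left to the
consumer; upper half `U ∈ [8, 8.5]` free in the anchor slack). Slots `M = ⌈total/1.41421356⌉₇`; exact replay
`pub/hubbard-fast/hubbard-box-p3/tables/filling_literals.json`. Generated by hand (hubbard-box-p3 g5).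

References: O. Bratteli, D. W. Robinson, OAQSM 1 (1987) §4.3.1 (convexity of the invariant states), OAQSM 2 (1997) §5.2.1–5.2.2 (Fock
state, gauge-invariant states); J. Wang et al., Phys. Rev. X 14 (2024) 031006 §III (Lagrangian reading of a relaxation certificate).
-/

noncomputable section

namespace Summit.Ventures.CertifiedManyBodySolver.Certificates

open Literature.MathematicalPhysics.QuantumLattice Literature.MathematicalPhysics.QuantumLattice.ThermodynamicLimit
open Literature.Probability.LatticeModels HubbardWave0 InfVolFermionState
open Summit.Ventures.CertifiedManyBodySolver
open scoped ComplexOrder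

/-! ### §1 Generic slots: a priced menu node at density `n₀` ⇒ pair-amplitude ceilings on a filling slab (anchor column / `t'`-box) -/

/-- **FILLING SLAB ABOVE THE NODE'S DENSITY, AT THE ANCHOR'S COUPLINGS** (vacuum partner): priced node at `(t'₀, U₀, h)`, density
`n₀ > 0` («√2·Re σ(P₀^d) ≤ M̃ + κ·(E^{src}(σ) − u₀)», `κ ≥ 0`); canonical caps `e(1,t'₀,U₀;n₀) ≤ R₀`, `e(1,t'₀,U₀;n₂) ≤ R₂` at the two
ends of the slab `[n₀, n₂]` (`n₂ < 2`); `0 ≤ M̃ − κu₀` and the slot inequality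
`M̃ + ((n₂ − n₀)/n₀)·(M̃ − κu₀) + κ·(max R₀ R₂ − u₀) ≤ M·1.41421356` ⇒ every density-`n` sourced minimiser at `(t'₀, U₀, h)`,
`n ∈ [n₀, n₂]`, has `Re ω(P₀^d) ≤ M` (convexity in `n` for the target cap; monotonicity of the price in `n`). Ceiling only. -/
theorem pairAmp_le_slot_on_fillingSlab_up_anchor_of_pricedNode {t'₀ U₀ h n₀ n₂ u₀ Mt κ R₀ R₂ M : ℝ} (hU₀ : 0 ≤ U₀)
    (hn₀ : 0 < n₀) (hn₂ : n₂ < 2) (hκ : 0 ≤ κ) (hM : 0 ≤ M)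
    (hP : ∀ σ : InfVolFermionState 2, σ.IsTranslationInvariant → σ.density = n₀ →
      Real.sqrt 2 * (σ.expect (pairRegion (insert 0 unitSteps) 0) (localPairAt (insert 0 unitSteps) dWaveFormFactor 0)).re ≤
        Mt + κ * (σ.meanEnergy (hubbardTTPrimeSourcedInteraction 1 t'₀ U₀ 0 dWaveFormFactor h) 1 - u₀))
    (hR₀ : energyDensityTT' 1 t'₀ U₀ n₀ ≤ R₀) (hR₂ : energyDensityTT' 1 t'₀ U₀ n₂ ≤ R₂) (hX : 0 ≤ Mt - κ * u₀)
    (hslot : Mt + (n₂ - n₀) / n₀ * (Mt - κ * u₀) + κ * (max R₀ R₂ - u₀) ≤ M * (141421356 / 100000000 : ℝ))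
    {n : ℝ} (hn : n ∈ Set.Icc n₀ n₂)
    {ω : InfVolFermionState 2} (hω : ω.IsTranslationInvariant) (hρ : ω.density = n)
    (hmin : ∀ ω' : InfVolFermionState 2, ω'.IsTranslationInvariant → ω'.density = n →
      ω.meanEnergy (hubbardTTPrimeSourcedInteraction 1 t'₀ U₀ 0 dWaveFormFactor h) 1 ≤
        ω'.meanEnergy (hubbardTTPrimeSourcedInteraction 1 t'₀ U₀ 0 dWaveFormFactor h) 1) :
    (ω.expect (pairRegion (insert 0 unitSteps) 0) (localPairAt (insert 0 unitSteps) dWaveFormFactor 0)).re ≤ M := by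
  have hR := energyDensityTT'_le_max_of_mem_Icc 1 t'₀ hU₀ (m₁ := n₀) (m₂ := n₂) hn₀.le hn₂ hR₀ hR₂ hn
  have key := canonicalMinimiser_sqrtTwo_mul_pairAmp_le_priced_of_menuNode_filling_up_anchor hU₀ hn₀ hn.1 (lt_of_le_of_lt hn.2 hn₂)
    hκ hP hR hω hρ hmin
  have hr : (n - n₀) / n₀ ≤ (n₂ - n₀) / n₀ := div_le_div_of_nonneg_right (by linarith [hn.2]) hn₀.le
  have hrX := mul_le_mul_of_nonneg_right hr hX
  exact le_slot_of_sqrt_two_mul_le (key.trans (by linarith)) hM hslot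

/-- **FILLING SLAB BELOW THE NODE'S DENSITY, AT THE ANCHOR'S COUPLINGS** (gauge-symmetric canonical partner of density `m > n₀` below
the canonical cap `e(1,t'₀,U₀;m) ≤ c`, `m < 2`): priced node at density `n₀`; caps `e(1,t'₀,U₀;n₁) ≤ R₁`, `e(1,t'₀,U₀;n₀) ≤ R₀` at the
ends of `[n₁, n₀]` (`n₁ ≥ 0`); `0 ≤ M̃ + κ(c − u₀)` and
`M̃ + ((n₀ − n₁)/(m − n₀))·(M̃ + κ(c − u₀)) + κ·(max R₁ R₀ − u₀) ≤ M·1.41421356` ⇒ every density-`n` sourced minimiser at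
`(t'₀, U₀, h)`, `n ∈ [n₁, n₀]`, has `Re ω(P₀^d) ≤ M`. Ceiling only. -/
theorem pairAmp_le_slot_on_fillingSlab_down_anchor_of_pricedNode {t'₀ U₀ h n₀ n₁ m u₀ Mt κ c R₁ R₀ M : ℝ} (hU₀ : 0 ≤ U₀)
    (hn₁ : 0 ≤ n₁) (hn₁₀ : n₁ ≤ n₀) (hm : n₀ < m) (hm2 : m < 2) (hκ : 0 ≤ κ) (hM : 0 ≤ M)
    (hP : ∀ σ : InfVolFermionState 2, σ.IsTranslationInvariant → σ.density = n₀ →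
      Real.sqrt 2 * (σ.expect (pairRegion (insert 0 unitSteps) 0) (localPairAt (insert 0 unitSteps) dWaveFormFactor 0)).re ≤
        Mt + κ * (σ.meanEnergy (hubbardTTPrimeSourcedInteraction 1 t'₀ U₀ 0 dWaveFormFactor h) 1 - u₀))
    (hc : energyDensityTT' 1 t'₀ U₀ m ≤ c) (hR₁ : energyDensityTT' 1 t'₀ U₀ n₁ ≤ R₁) (hR₀ : energyDensityTT' 1 t'₀ U₀ n₀ ≤ R₀)
    (hY : 0 ≤ Mt + κ * (c - u₀))
    (hslot : Mt + (n₀ - n₁) / (m - n₀) * (Mt + κ * (c - u₀)) + κ * (max R₁ R₀ - u₀) ≤ M * (141421356 / 100000000 : ℝ))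
    {n : ℝ} (hn : n ∈ Set.Icc n₁ n₀)
    {ω : InfVolFermionState 2} (hω : ω.IsTranslationInvariant) (hρ : ω.density = n)
    (hmin : ∀ ω' : InfVolFermionState 2, ω'.IsTranslationInvariant → ω'.density = n →
      ω.meanEnergy (hubbardTTPrimeSourcedInteraction 1 t'₀ U₀ 0 dWaveFormFactor h) 1 ≤
        ω'.meanEnergy (hubbardTTPrimeSourcedInteraction 1 t'₀ U₀ 0 dWaveFormFactor h) 1) :
    (ω.expect (pairRegion (insert 0 unitSteps) 0) (localPairAt (insert 0 unitSteps) dWaveFormFactor 0)).re ≤ M := by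
  have hm0 : 0 ≤ m := by linarith
  have hR := energyDensityTT'_le_max_of_mem_Icc 1 t'₀ hU₀ (m₁ := n₁) (m₂ := n₀) hn₁ (by linarith) hR₁ hR₀ hn
  have key := canonicalMinimiser_sqrtTwo_mul_pairAmp_le_priced_of_menuNode_filling_of_canonicalPartner_anchor hU₀ (hn₁.trans hn.1)
    (by linarith [hn.2]) hm0 hm2 hκ hP hc (Or.inr ⟨hn.2, hm⟩) hR hω hρ hmin
  -- `(n - n₀)/(n₀ - m) = (n₀ - n)/(m - n₀) ≤ (n₀ - n₁)/(m - n₀)`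
  have hmn : 0 < m - n₀ := by linarith
  have hr : (n - n₀) / (n₀ - m) ≤ (n₀ - n₁) / (m - n₀) := by
    rw [show (n - n₀) / (n₀ - m) = (n₀ - n) / (m - n₀) by rw [← neg_sub n₀ n, ← neg_sub m n₀, neg_div_neg_eq]]
    exact div_le_div_of_nonneg_right (by linarith [hn.1]) hmn.le
  have hrY := mul_le_mul_of_nonneg_right hr hY
  exact le_slot_of_sqrt_two_mul_le (key.trans (by linarith)) hM hslot

/-- **FILLING SLAB ABOVE THE NODE'S DENSITY ON A `t'`-BOX AROUND THE ANCHOR** (`U = U₀`; vacuum partner; kinematic anchor slack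
`16/π²·|t'₀ − t'| < 1.6212·r`): priced node at `(t'₀, U₀, h)`, density `n₀ > 0`; for every `t'` with `|t'₀ − t'| ≤ r` target caps
`e(1,t',U₀;n₀) ≤ R₀`, `e(1,t',U₀;n₂) ≤ R₂` (numbers uniform on the box); `0 ≤ M̃ − κu₀`;
`M̃ + ((n₂ − n₀)/n₀)·(M̃ − κu₀) + κ·(max R₀ R₂ + 1.6212·r − u₀) ≤ M·1.41421356` ⇒ every density-`n` sourced minimiser at `(t', U₀, h)`,
`n ∈ [n₀, n₂]`, has `Re ω(P₀^d) ≤ M`. Ceiling only. -/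
theorem pairAmp_le_slot_on_fillingSlab_up_tPrimeBox_of_pricedNode {t'₀ U₀ h n₀ n₂ u₀ Mt κ R₀ R₂ r M : ℝ} (hU₀ : 0 ≤ U₀)
    (hn₀ : 0 < n₀) (hn₂ : n₂ < 2) (hκ : 0 ≤ κ) (hM : 0 ≤ M)
    (hP : ∀ σ : InfVolFermionState 2, σ.IsTranslationInvariant → σ.density = n₀ →
      Real.sqrt 2 * (σ.expect (pairRegion (insert 0 unitSteps) 0) (localPairAt (insert 0 unitSteps) dWaveFormFactor 0)).re ≤
        Mt + κ * (σ.meanEnergy (hubbardTTPrimeSourcedInteraction 1 t'₀ U₀ 0 dWaveFormFactor h) 1 - u₀))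
    (hR₀ : ∀ t' : ℝ, |t'₀ - t'| ≤ r → energyDensityTT' 1 t' U₀ n₀ ≤ R₀)
    (hR₂ : ∀ t' : ℝ, |t'₀ - t'| ≤ r → energyDensityTT' 1 t' U₀ n₂ ≤ R₂) (hX : 0 ≤ Mt - κ * u₀)
    (hslot : Mt + (n₂ - n₀) / n₀ * (Mt - κ * u₀) + κ * (max R₀ R₂ + 1.6212 * r - u₀) ≤ M * (141421356 / 100000000 : ℝ))
    {t' : ℝ} (ht : |t'₀ - t'| ≤ r) {n : ℝ} (hn : n ∈ Set.Icc n₀ n₂)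
    {ω : InfVolFermionState 2} (hω : ω.IsTranslationInvariant) (hρ : ω.density = n)
    (hmin : ∀ ω' : InfVolFermionState 2, ω'.IsTranslationInvariant → ω'.density = n →
      ω.meanEnergy (hubbardTTPrimeSourcedInteraction 1 t' U₀ 0 dWaveFormFactor h) 1 ≤
        ω'.meanEnergy (hubbardTTPrimeSourcedInteraction 1 t' U₀ 0 dWaveFormFactor h) 1) :
    (ω.expect (pairRegion (insert 0 unitSteps) 0) (localPairAt (insert 0 unitSteps) dWaveFormFactor 0)).re ≤ M := by
  have hR := energyDensityTT'_le_max_of_mem_Icc 1 t' hU₀ (m₁ := n₀) (m₂ := n₂) hn₀.le hn₂ (hR₀ t' ht) (hR₂ t' ht) hn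
  have key := canonicalMinimiser_sqrtTwo_mul_pairAmp_le_priced_of_menuNode_filling_up_tPrime_U (U₀ := U₀) (U := U₀) hU₀ hn₀ hn.1
    (lt_of_le_of_lt hn.2 hn₂) hκ hP hR hω hρ hmin
  simp only [sub_self, max_self, zero_mul, add_zero] at key
  have hr : (n - n₀) / n₀ ≤ (n₂ - n₀) / n₀ := div_le_div_of_nonneg_right (by linarith [hn.2]) hn₀.le
  have hrX := mul_le_mul_of_nonneg_right hr hX
  have hpi := sixteen_div_pi_sq_lt_decimal
  have hkin : κ * (max R₀ R₂ + 16 / Real.pi ^ 2 * |t'₀ - t'| - u₀) ≤ κ * (max R₀ R₂ + 1.6212 * r - u₀) := by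
    apply mul_le_mul_of_nonneg_left _ hκ
    have h0 : 0 ≤ |t'₀ - t'| := abs_nonneg _
    nlinarith [mul_le_mul_of_nonneg_left ht (show (0:ℝ) ≤ 1.6212 by norm_num), mul_le_mul_of_nonneg_right hpi.le h0]
  exact le_slot_of_sqrt_two_mul_le (key.trans (by linarith)) hM hslot

/-- **FILLING SLAB BELOW THE NODE'S DENSITY ON A `t'`-BOX AROUND THE ANCHOR** (`U = U₀`; gauge-symmetric canonical partner at the
ANCHOR, `e(1,t'₀,U₀;m) ≤ c`, `n₀ < m < 2`): for every `t'` with `|t'₀ − t'| ≤ r` target caps `e(1,t',U₀;n₁) ≤ R₁`, `e(1,t',U₀;n₀) ≤ R₀`;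
`0 ≤ M̃ + κ(c − u₀)`; `M̃ + ((n₀ − n₁)/(m − n₀))·(M̃ + κ(c − u₀)) + κ·(max R₁ R₀ + 1.6212·r − u₀) ≤ M·1.41421356` ⇒ every density-`n`
sourced minimiser at `(t', U₀, h)`, `n ∈ [n₁, n₀]`, has `Re ω(P₀^d) ≤ M`. Ceiling only. -/
theorem pairAmp_le_slot_on_fillingSlab_down_tPrimeBox_of_pricedNode {t'₀ U₀ h n₀ n₁ m u₀ Mt κ c R₁ R₀ r M : ℝ} (hU₀ : 0 ≤ U₀)
    (hn₁ : 0 ≤ n₁) (hn₁₀ : n₁ ≤ n₀) (hm : n₀ < m) (hm2 : m < 2) (hκ : 0 ≤ κ) (hM : 0 ≤ M)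
    (hP : ∀ σ : InfVolFermionState 2, σ.IsTranslationInvariant → σ.density = n₀ →
      Real.sqrt 2 * (σ.expect (pairRegion (insert 0 unitSteps) 0) (localPairAt (insert 0 unitSteps) dWaveFormFactor 0)).re ≤
        Mt + κ * (σ.meanEnergy (hubbardTTPrimeSourcedInteraction 1 t'₀ U₀ 0 dWaveFormFactor h) 1 - u₀))
    (hc : energyDensityTT' 1 t'₀ U₀ m ≤ c)
    (hR₁ : ∀ t' : ℝ, |t'₀ - t'| ≤ r → energyDensityTT' 1 t' U₀ n₁ ≤ R₁)
    (hR₀ : ∀ t' : ℝ, |t'₀ - t'| ≤ r → energyDensityTT' 1 t' U₀ n₀ ≤ R₀) (hY : 0 ≤ Mt + κ * (c - u₀))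
    (hslot : Mt + (n₀ - n₁) / (m - n₀) * (Mt + κ * (c - u₀)) + κ * (max R₁ R₀ + 1.6212 * r - u₀) ≤
      M * (141421356 / 100000000 : ℝ))
    {t' : ℝ} (ht : |t'₀ - t'| ≤ r) {n : ℝ} (hn : n ∈ Set.Icc n₁ n₀)
    {ω : InfVolFermionState 2} (hω : ω.IsTranslationInvariant) (hρ : ω.density = n)
    (hmin : ∀ ω' : InfVolFermionState 2, ω'.IsTranslationInvariant → ω'.density = n →
      ω.meanEnergy (hubbardTTPrimeSourcedInteraction 1 t' U₀ 0 dWaveFormFactor h) 1 ≤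
        ω'.meanEnergy (hubbardTTPrimeSourcedInteraction 1 t' U₀ 0 dWaveFormFactor h) 1) :
    (ω.expect (pairRegion (insert 0 unitSteps) 0) (localPairAt (insert 0 unitSteps) dWaveFormFactor 0)).re ≤ M := by
  have hm0 : 0 ≤ m := by linarith
  have hR := energyDensityTT'_le_max_of_mem_Icc 1 t' hU₀ (m₁ := n₁) (m₂ := n₀) hn₁ (by linarith) (hR₁ t' ht) (hR₀ t' ht) hn
  have key := canonicalMinimiser_sqrtTwo_mul_pairAmp_le_priced_of_menuNode_filling_of_canonicalPartner_tPrime_U (U₀ := U₀) (U := U₀)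
    hU₀ hU₀ (hn₁.trans hn.1) (by linarith [hn.2]) hm0 hm2 hκ hP hc (Or.inr ⟨hn.2, hm⟩) hR hω hρ hmin
  simp only [sub_self, max_self, zero_mul, add_zero] at key
  have hmn : 0 < m - n₀ := by linarith
  have hr : (n - n₀) / (n₀ - m) ≤ (n₀ - n₁) / (m - n₀) := by
    rw [show (n - n₀) / (n₀ - m) = (n₀ - n) / (m - n₀) by rw [← neg_sub n₀ n, ← neg_sub m n₀, neg_div_neg_eq]]
    exact div_le_div_of_nonneg_right (by linarith [hn.1]) hmn.le
  have hrY := mul_le_mul_of_nonneg_right hr hY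
  have hpi := sixteen_div_pi_sq_lt_decimal
  have hkin : κ * (max R₁ R₀ + 16 / Real.pi ^ 2 * |t'₀ - t'| - u₀) ≤ κ * (max R₁ R₀ + 1.6212 * r - u₀) := by
    apply mul_le_mul_of_nonneg_left _ hκ
    have h0 : 0 ≤ |t'₀ - t'| := abs_nonneg _
    nlinarith [mul_le_mul_of_nonneg_left ht (show (0:ℝ) ≤ 1.6212 by norm_num), mul_le_mul_of_nonneg_right hpi.le h0]
  exact le_slot_of_sqrt_two_mul_le (key.trans (by linarith)) hM hslot

/-! ### §2 Registry-derived caps at the anchor column `(U, t') = (8, −1/4)` and on the cuprate `t'`-box -/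

/-- **Half-filling cap at every `t'` from #472** (`e(1,0,8;1) ≤ C₄₇₂`; evenness + concavity in `t'` at `n = 1`,
`box3d_halfFilling_cap_of_tp0`). -/
theorem halfFilling_cap_U8_of_r472 (h472 : cert_r472_pb2_tl_upper_n1_U8) (t' : ℝ) :
    energyDensityTT' 1 t' 8 1 ≤ (((-4475209735223/8796093022208 : ℚ)) : ℝ) := by
  have h := m2_U8_upper_r472_of h472
  unfold M2EnergyUpperRow at h
  rw [← energyDensityTT'_zero 1 8 1] at h
  exact box3d_halfFilling_cap_of_tp0 (by norm_num) h t'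

/-- **Cap at `(8, −1/4, 177/200)`**: the density chord between #445 at `7/8` and C₄₇₂ at `1`: `(23/25)·hi₄₄₅ + (2/25)·C₄₇₂ = −0.6724122376…`. -/
theorem cap_U8_tpm1o4_n177o200_of (h445 : cert_dbt329pair_allk) (h472 : cert_r472_pb2_tl_upper_n1_U8) :
    energyDensityTT' 1 (-1/4) 8 (177/200) ≤ (((-295730029562283/439804651110400 : ℚ)) : ℝ) := by
  have h := energyDensityTT'_le_density_chord 1 (-1/4) (U := 8) (by norm_num) (n₁ := 7/8) (n := 177/200) (n₂ := 1)
    (by norm_num) (by norm_num) (by norm_num) (by norm_num) (energyDensityTT'_le_hi445_of_node h445) (halfFilling_cap_U8_of_r472 h472 _)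
  refine h.trans (le_of_eq ?_)
  push_cast
  norm_num

/-- **Cap at `(8, −1/4, 173/200)`**: the vacuum chord of #445: `(173/175)·hi₄₄₅ = −0.6787944502…`. -/
theorem cap_U8_tpm1o4_n173o200_of (h445 : cert_dbt329pair_allk) :
    energyDensityTT' 1 (-1/4) 8 (173/200) ≤ (((-2089758694673941/3078632557772800 : ℚ)) : ℝ) := by
  have h := energyDensityTT'_le_vacuum_chord 1 (-1/4) (U := 8) (by norm_num) (n := 173/200) (n₂ := 7/8)
    (by norm_num) (by norm_num) (by norm_num) (energyDensityTT'_le_hi445_of_node h445)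
  refine h.trans (le_of_eq ?_)
  push_cast
  norm_num

/-- **Cap at `(8, t', 7/8)` on the cuprate `t'`-box** (kinematic transport of #445 at `16/π² < 1.6212`, `|t' + 1/4| ≤ 1/20`):
`e ≤ hi₄₄₅ + 1.6212/20 = −0.6055817849…`. -/
theorem cap_U8_tPrimeBox_n7o8_of (h445 : cert_dbt329pair_allk) {t' : ℝ} (ht : |((-1/4 : ℝ)) - t'| ≤ 1 / 20) :
    energyDensityTT' 1 t' 8 (7/8) ≤ (((-33292210707051997/54975581388800000 : ℚ)) : ℝ) := by
  have h := energyDensityTT'_le_of_upperBound_tPrime_kinematic 1 (U := 8) (by norm_num) (n := 7/8) (by norm_num) (by norm_num)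
    (s := -1/4) (s' := t') (energyDensityTT'_le_hi445_of_node h445)
  have hpi := sixteen_div_pi_sq_lt_decimal
  rw [abs_sub_comm] at h
  have h0 : 0 ≤ |((-1/4 : ℝ)) - t'| := abs_nonneg _
  have hk : 16 / Real.pi ^ 2 * |((-1/4 : ℝ)) - t'| ≤ 1.6212 * (1 / 20) := by
    nlinarith [mul_le_mul_of_nonneg_left ht (show (0:ℝ) ≤ 1.6212 by norm_num), mul_le_mul_of_nonneg_right hpi.le h0]
  have h' : energyDensityTT' 1 t' 8 (7/8) ≤ (((-12079530027017/17592186044416 : ℚ)) : ℝ) + 1.6212 * (1 / 20) := by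
    linarith
  refine h'.trans (le_of_eq ?_)
  push_cast
  norm_num

/-- **Cap at `(8, t', 177/200)` on the `t'`-box**: density chord of the box cap at `7/8` and C₄₇₂ at `1`: `−0.5978370376…`. -/
theorem cap_U8_tPrimeBox_n177o200_of (h445 : cert_dbt329pair_allk) (h472 : cert_r472_pb2_tl_upper_n1_U8) {t' : ℝ}
    (ht : |((-1/4 : ℝ)) - t'| ≤ 1 / 20) :
    energyDensityTT' 1 t' 8 (177/200) ≤ (((-821660967952483431/1374389534720000000 : ℚ)) : ℝ) := by
  have h := energyDensityTT'_le_density_chord 1 t' (U := 8) (by norm_num) (n₁ := 7/8) (n := 177/200) (n₂ := 1)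
    (by norm_num) (by norm_num) (by norm_num) (by norm_num) (cap_U8_tPrimeBox_n7o8_of h445 ht) (halfFilling_cap_U8_of_r472 h472 _)
  refine h.trans (le_of_eq ?_)
  push_cast
  norm_num

/-- **Cap at `(8, t', 173/200)` on the `t'`-box**: vacuum chord of the box cap at `7/8`: `−0.5986608502…`. -/
theorem cap_U8_tPrimeBox_n173o200_of (h445 : cert_dbt329pair_allk) {t' : ℝ} (ht : |((-1/4 : ℝ)) - t'| ≤ 1 / 20) :
    energyDensityTT' 1 t' 8 (173/200) ≤ (((-5759552452319995481/9620726743040000000 : ℚ)) : ℝ) := by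
  have h := energyDensityTT'_le_vacuum_chord 1 t' (U := 8) (by norm_num) (n := 173/200) (n₂ := 7/8)
    (by norm_num) (by norm_num) (by norm_num) (cap_U8_tPrimeBox_n7o8_of h445 ht)
  refine h.trans (le_of_eq ?_)
  push_cast
  norm_num

/-! ### §3 A0 L2 g = 0 (the ORDER class, `h = 0`): the filling extent of the cuprate box at the anchor column `(8, −1/4)` -/

/-- **ORDER-CLASS FILLING-SLAB CEILING, UPPER HALF, from node `cert_pin2_A0menu_L2_U8_n7o8_tpm1o4_g0_pairAmpMax_priced_j256528`**
(A0 = (8, 7/8, −1/4); M̃ = 1.0748043, κ = 1.1906556; anchor slot 0.7600015): at `(U, t') = (8, −1/4)`, for every `n ∈ [0.875, 0.885]`,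
every translation-invariant density-`n` GROUND STATE of the unsourced `t–t'` Hubbard model has **`Re ω(P₀^d) ≤ 0.7872742`**
(slot `3936371/5000000` = ⌈(M̃ + (2/175)(M̃ − κ·hi₄₄₅) + κ·(chord₈₈₅ − hi₄₄₅))/1.41421356⌉₇; vacuum partner). Premises BY NAME: the priced
node (CANDIDATE, referee pending), #445, #472. Ceiling only; never speaks to presence; no phase sentence. -/
theorem pin2_A0menu_L2_g0_groundState_pairAmp_le_on_fillingSlab_up_anchor_of_pricedNode
    (hP : cert_pin2_A0menu_L2_U8_n7o8_tpm1o4_g0_pairAmpMax_priced_j256528) (h445 : cert_dbt329pair_allk)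
    (h472 : cert_r472_pb2_tl_upper_n1_U8)
    {n : ℝ} (hn : n ∈ Set.Icc (7/8 : ℝ) (177/200))
    {ω : InfVolFermionState 2} (hω : ω.IsTranslationInvariant) (hρ : ω.density = n)
    (hmin : ∀ ω' : InfVolFermionState 2, ω'.IsTranslationInvariant → ω'.density = n →
      ω.meanEnergy (hubbardTTPrimeSourcedInteraction 1 (-1/4) 8 0 dWaveFormFactor 0) 1 ≤
        ω'.meanEnergy (hubbardTTPrimeSourcedInteraction 1 (-1/4) 8 0 dWaveFormFactor 0) 1) :
    (ω.expect (pairRegion (insert 0 unitSteps) 0) (localPairAt (insert 0 unitSteps) dWaveFormFactor 0)).re ≤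
      (((3936371/5000000 : ℚ)) : ℝ) := by
  refine pairAmp_le_slot_on_fillingSlab_up_anchor_of_pricedNode (t'₀ := (-1/4)) (U₀ := 8) (n₀ := 7/8) (n₂ := 177/200)
    (by norm_num) (by norm_num) (by norm_num) (by norm_num) (by norm_num) hP
    (energyDensityTT'_le_hi445_of_node h445) (cap_U8_tpm1o4_n177o200_of h445 h472) (by norm_num) ?_ hn hω hρ hmin
  rw [max_eq_right (by norm_num)]
  norm_num

/-- **ORDER-CLASS FILLING-SLAB CEILING, LOWER HALF** (same node; gauge-symmetric half-filled partner below C₄₇₂): at `(8, −1/4)`, for every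
`n ∈ [0.865, 0.875]`, every translation-invariant density-`n` ground state has **`Re ω(P₀^d) ≤ 0.8393886`** (slot `4196943/5000000` =
⌈(M̃ + (2/25)(M̃ + κ(C₄₇₂ − hi₄₄₅)) + κ·((173/175 − 1)·hi₄₄₅))/1.41421356⌉₇). Premises BY NAME: the priced node (CANDIDATE), #445, #472.
Ceiling only; no phase sentence. -/
theorem pin2_A0menu_L2_g0_groundState_pairAmp_le_on_fillingSlab_down_anchor_of_pricedNode
    (hP : cert_pin2_A0menu_L2_U8_n7o8_tpm1o4_g0_pairAmpMax_priced_j256528) (h445 : cert_dbt329pair_allk)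
    (h472 : cert_r472_pb2_tl_upper_n1_U8)
    {n : ℝ} (hn : n ∈ Set.Icc (173/200 : ℝ) (7/8))
    {ω : InfVolFermionState 2} (hω : ω.IsTranslationInvariant) (hρ : ω.density = n)
    (hmin : ∀ ω' : InfVolFermionState 2, ω'.IsTranslationInvariant → ω'.density = n →
      ω.meanEnergy (hubbardTTPrimeSourcedInteraction 1 (-1/4) 8 0 dWaveFormFactor 0) 1 ≤
        ω'.meanEnergy (hubbardTTPrimeSourcedInteraction 1 (-1/4) 8 0 dWaveFormFactor 0) 1) :
    (ω.expect (pairRegion (insert 0 unitSteps) 0) (localPairAt (insert 0 unitSteps) dWaveFormFactor 0)).re ≤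
      (((4196943/5000000 : ℚ)) : ℝ) := by
  refine pairAmp_le_slot_on_fillingSlab_down_anchor_of_pricedNode (t'₀ := (-1/4)) (U₀ := 8) (n₀ := 7/8) (n₁ := 173/200) (m := 1)
    (by norm_num) (by norm_num) (by norm_num) (by norm_num) (by norm_num) (by norm_num) (by norm_num) hP
    (halfFilling_cap_U8_of_r472 h472 _) (cap_U8_tpm1o4_n173o200_of h445) (energyDensityTT'_le_hi445_of_node h445) (by norm_num) ?_
    hn hω hρ hmin
  rw [max_eq_left (by norm_num)]
  norm_num

/-- **ORDER-CLASS CEILING ON THE WHOLE FILLING SLAB `n ∈ [0.865, 0.885]` at `(8, −1/4)`**: **`Re ω(P₀^d) ≤ 0.8393886`** for every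
translation-invariant density-`n` ground state (the two halves above). Premises BY NAME: the priced node (CANDIDATE), #445, #472.
Ceiling only; no phase sentence. -/
theorem pin2_A0menu_L2_g0_groundState_pairAmp_le_on_fillingSlab_anchor_of_pricedNode
    (hP : cert_pin2_A0menu_L2_U8_n7o8_tpm1o4_g0_pairAmpMax_priced_j256528) (h445 : cert_dbt329pair_allk)
    (h472 : cert_r472_pb2_tl_upper_n1_U8)
    {n : ℝ} (hn : n ∈ Set.Icc (173/200 : ℝ) (177/200))
    {ω : InfVolFermionState 2} (hω : ω.IsTranslationInvariant) (hρ : ω.density = n)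
    (hmin : ∀ ω' : InfVolFermionState 2, ω'.IsTranslationInvariant → ω'.density = n →
      ω.meanEnergy (hubbardTTPrimeSourcedInteraction 1 (-1/4) 8 0 dWaveFormFactor 0) 1 ≤
        ω'.meanEnergy (hubbardTTPrimeSourcedInteraction 1 (-1/4) 8 0 dWaveFormFactor 0) 1) :
    (ω.expect (pairRegion (insert 0 unitSteps) 0) (localPairAt (insert 0 unitSteps) dWaveFormFactor 0)).re ≤
      (((4196943/5000000 : ℚ)) : ℝ) := by
  rcases le_total n (7/8) with h | h
  · exact pin2_A0menu_L2_g0_groundState_pairAmp_le_on_fillingSlab_down_anchor_of_pricedNode hP h445 h472 ⟨hn.1, h⟩ hω hρ hmin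
  · exact (pin2_A0menu_L2_g0_groundState_pairAmp_le_on_fillingSlab_up_anchor_of_pricedNode hP h445 h472 ⟨h, hn.2⟩ hω hρ hmin).trans
      (by norm_num)

/-! ### §4 A0 L2 g = 0: the `(t', n)` face `[−3/10, −1/5] × [173/200, 177/200]` of the cuprate box at `U = 8` -/

/-- **ORDER-CLASS `(t', n)`-FACE CEILING, UPPER FILLING HALF** (node A0 L2 g = 0; vacuum partner; kinematic registry-only `t'` transport):
for every `t' ∈ [−0.30, −0.20]` and `n ∈ [0.875, 0.885]` (`U = 8`), every translation-invariant density-`n` ground state of the unsourced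
`t–t'` model has **`Re ω(P₀^d) ≤ 0.9183067`** (slot `9183067/10000000`). Premises BY NAME: the priced node (CANDIDATE), #445, #472.
Ceiling only; no phase sentence. -/
theorem pin2_A0menu_L2_g0_groundState_pairAmp_le_on_tPrimeFillingFace_up_of_pricedNode
    (hP : cert_pin2_A0menu_L2_U8_n7o8_tpm1o4_g0_pairAmpMax_priced_j256528) (h445 : cert_dbt329pair_allk)
    (h472 : cert_r472_pb2_tl_upper_n1_U8)
    {t' : ℝ} (ht : t' ∈ Set.Icc (-3/10 : ℝ) (-1/5)) {n : ℝ} (hn : n ∈ Set.Icc (7/8 : ℝ) (177/200))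
    {ω : InfVolFermionState 2} (hω : ω.IsTranslationInvariant) (hρ : ω.density = n)
    (hmin : ∀ ω' : InfVolFermionState 2, ω'.IsTranslationInvariant → ω'.density = n →
      ω.meanEnergy (hubbardTTPrimeSourcedInteraction 1 t' 8 0 dWaveFormFactor 0) 1 ≤
        ω'.meanEnergy (hubbardTTPrimeSourcedInteraction 1 t' 8 0 dWaveFormFactor 0) 1) :
    (ω.expect (pairRegion (insert 0 unitSteps) 0) (localPairAt (insert 0 unitSteps) dWaveFormFactor 0)).re ≤
      (((9183067/10000000 : ℚ)) : ℝ) := by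
  have hr : |((-1/4) : ℝ) - t'| ≤ 1 / 20 := by
    rw [abs_le]; constructor <;> linarith [ht.1, ht.2]
  refine pairAmp_le_slot_on_fillingSlab_up_tPrimeBox_of_pricedNode (t'₀ := (-1/4)) (U₀ := 8) (n₀ := 7/8) (n₂ := 177/200) (r := 1/20)
    (by norm_num) (by norm_num) (by norm_num) (by norm_num) (by norm_num) hP
    (fun s hs => cap_U8_tPrimeBox_n7o8_of h445 hs) (fun s hs => cap_U8_tPrimeBox_n177o200_of h445 h472 hs) (by norm_num) ?_ hr hn
    hω hρ hmin
  rw [max_eq_right (by norm_num)]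
  norm_num

/-- **ORDER-CLASS `(t', n)`-FACE CEILING, LOWER FILLING HALF** (gauge-symmetric half-filled partner at the anchor below C₄₇₂): for every
`t' ∈ [−0.30, −0.20]` and `n ∈ [0.865, 0.875]` (`U = 8`), every translation-invariant density-`n` ground state has
**`Re ω(P₀^d) ≤ 0.9751008`** (slot `304719/312500`). Premises BY NAME: the priced node (CANDIDATE), #445, #472. Ceiling only; no phase
sentence. -/
theorem pin2_A0menu_L2_g0_groundState_pairAmp_le_on_tPrimeFillingFace_down_of_pricedNode
    (hP : cert_pin2_A0menu_L2_U8_n7o8_tpm1o4_g0_pairAmpMax_priced_j256528) (h445 : cert_dbt329pair_allk)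
    (h472 : cert_r472_pb2_tl_upper_n1_U8)
    {t' : ℝ} (ht : t' ∈ Set.Icc (-3/10 : ℝ) (-1/5)) {n : ℝ} (hn : n ∈ Set.Icc (173/200 : ℝ) (7/8))
    {ω : InfVolFermionState 2} (hω : ω.IsTranslationInvariant) (hρ : ω.density = n)
    (hmin : ∀ ω' : InfVolFermionState 2, ω'.IsTranslationInvariant → ω'.density = n →
      ω.meanEnergy (hubbardTTPrimeSourcedInteraction 1 t' 8 0 dWaveFormFactor 0) 1 ≤
        ω'.meanEnergy (hubbardTTPrimeSourcedInteraction 1 t' 8 0 dWaveFormFactor 0) 1) :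
    (ω.expect (pairRegion (insert 0 unitSteps) 0) (localPairAt (insert 0 unitSteps) dWaveFormFactor 0)).re ≤
      (((304719/312500 : ℚ)) : ℝ) := by
  have hr : |((-1/4) : ℝ) - t'| ≤ 1 / 20 := by
    rw [abs_le]; constructor <;> linarith [ht.1, ht.2]
  refine pairAmp_le_slot_on_fillingSlab_down_tPrimeBox_of_pricedNode (t'₀ := (-1/4)) (U₀ := 8) (n₀ := 7/8) (n₁ := 173/200) (m := 1)
    (r := 1/20) (by norm_num) (by norm_num) (by norm_num) (by norm_num) (by norm_num) (by norm_num) (by norm_num) hP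
    (halfFilling_cap_U8_of_r472 h472 _) (fun s hs => cap_U8_tPrimeBox_n173o200_of h445 hs) (fun s hs => cap_U8_tPrimeBox_n7o8_of h445 hs)
    (by norm_num) ?_ hr hn hω hρ hmin
  rw [max_eq_left (by norm_num)]
  norm_num

/-- **ORDER-CLASS CEILING ON THE WHOLE `(t', n)` FACE `[−0.30, −0.20] × [0.865, 0.885]` AT `U = 8`**: **`Re ω(P₀^d) ≤ 0.9751008`** for every
translation-invariant density-`n` ground state of the unsourced `t–t'` Hubbard model at `(t', 8)` (the two halves above; the `t'`-extent alone
at `n = 7/8` is `0.8964936`, `…menus_tPrimeBox_pairAmpCeilings`). Premises BY NAME: the priced node (CANDIDATE), #445, #472. Ceiling only;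
never speaks to presence; no phase sentence. -/
theorem pin2_A0menu_L2_g0_groundState_pairAmp_le_on_tPrimeFillingFace_of_pricedNode
    (hP : cert_pin2_A0menu_L2_U8_n7o8_tpm1o4_g0_pairAmpMax_priced_j256528) (h445 : cert_dbt329pair_allk)
    (h472 : cert_r472_pb2_tl_upper_n1_U8)
    {t' : ℝ} (ht : t' ∈ Set.Icc (-3/10 : ℝ) (-1/5)) {n : ℝ} (hn : n ∈ Set.Icc (173/200 : ℝ) (177/200))
    {ω : InfVolFermionState 2} (hω : ω.IsTranslationInvariant) (hρ : ω.density = n)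
    (hmin : ∀ ω' : InfVolFermionState 2, ω'.IsTranslationInvariant → ω'.density = n →
      ω.meanEnergy (hubbardTTPrimeSourcedInteraction 1 t' 8 0 dWaveFormFactor 0) 1 ≤
        ω'.meanEnergy (hubbardTTPrimeSourcedInteraction 1 t' 8 0 dWaveFormFactor 0) 1) :
    (ω.expect (pairRegion (insert 0 unitSteps) 0) (localPairAt (insert 0 unitSteps) dWaveFormFactor 0)).re ≤
      (((304719/312500 : ℚ)) : ℝ) := by
  rcases le_total n (7/8) with h | h
  · exact pin2_A0menu_L2_g0_groundState_pairAmp_le_on_tPrimeFillingFace_down_of_pricedNode hP h445 h472 ht ⟨hn.1, h⟩ hω hρ hmin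
  · exact (pin2_A0menu_L2_g0_groundState_pairAmp_le_on_tPrimeFillingFace_up_of_pricedNode hP h445 h472 ht ⟨h, hn.2⟩ hω hρ hmin).trans
      (by norm_num)

end Summit.Ventures.CertifiedManyBodySolver.Certificates

end
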